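import Summits.KontsevichZagierPeriods.KontsevichZagierPeriods.Theorems.UnfoldedStokesStokesGenerationFibrewiseRungSaAngularSector
import Summits.KontsevichZagierPeriods.KontsevichZagierPeriods.Theorems.UnfoldedStokesStokesGenerationFibrewiseRungSaDlogSector
import Summits.KontsevichZagierPeriods.KontsevichZagierPeriods.Theorems.UnfoldedStokesStokesGenerationStubSaLoopAngleExp
import Summits.KontsevichZagierPeriods.KontsevichZagierPeriods.Theorems.UnfoldedStokesStokesGenerationStubSaLoopZPow
import Summits.KontsevichZagierPeriods.KontsevichZagierPeriods.Theorems.UnfoldedStokesStokesGenerationStubSaMixedValue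

/-!
# `StokesGeneration` (stmt-KontsevichZagierPeriods-3586), line `fibrewise_stokes` — rung 10c: the mixed layer of dimension one with semialgebraic data

Crux `Summit.KontsevichZagierPeriods.KontsevichZagierPeriods.Theses.UnfoldedStokes.StokesGeneration`; residual S2 =
`FibrewiseStokesGenerationConjecture`. Rung 10 (lead c5) generalises the dimension-one Baker layer of S2 from polynomial to
SEMIALGEBRAIC data; this file completes it: **every logarithmic differential `dG₀ + Σ cᵢ dlog fᵢ + Σ dₖ d arg(Aₖ + iBₖ)` on `[0,1]` with
`ℚ`-semialgebraic `C¹` data (`fᵢ > 0`, `Aₖ² + Bₖ² > 0`, algebraic `cᵢ, dₖ`) and value `0` is fibrewise-Stokes decomposable**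
(`fibStokesDecomposable_saDimOneMixed`) — everything below genus one in dimension one. Rung 8 parts I–II verbatim with functions:
`e^{iΘₖ}` algebraic (`stub_saLoopAngleExp`, p132290), the value formula (`stub_saMixedValue`, p132668), Baker's theorem in mixed
decomposition form (R8) kills the algebraic constant and separates the dlog and angular halves, the former is rung 10a (p132724),
the latter `fibStokesDecomposable_saAngularMulti` (integer angle relations realised by product loops `stub_saLoopZPow`, p132777,
of total angle `0`, closed by rung 10b, p132864).

References: M. Kontsevich, D. Zagier, *Periods* (2001), §1.1–1.2; J. Ayoub, Ann. of Math. 181 (2015), Conj. 1.1, Rem. 1.5;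
A. Baker, *Transcendental Number Theory* (1975), Ch. 2, Thm. 2.1.
-/

noncomputable section

set_option linter.dupNamespace false

namespace Summit.KontsevichZagierPeriods.KontsevichZagierPeriods.Cruxes.StokesGeneration.FibrewiseStokes

open MeasureTheory Set
open Literature.NumberTheory.Transcendental
open Literature.NumberTheory.Transcendental.KZ
open Literature.ModelTheory.ExponentialFields (IsSemialgebraic)

/-- **S2 on the angular multi-loop sector for SEMIALGEBRAIC loops (rung 10c, part I; lead c5).** Rung 8 part I verbatim with
`C¹` semialgebraic loops: `e^{iΘₖ}` algebraic (`stub_saLoopAngleExp`, p132290), mixed Baker with no logarithms (R8), product loops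
(`stub_saLoopZPow`, p132777), the semialgebraic angular sector (rung 10b), closure. [cite: Baker1975, Thm 2.1] -/
theorem fibStokesDecomposable_saAngularMulti (s : ℕ) (d : Fin s → ℝ) (A B A' B' : Fin s → ℝ → ℝ)
    (hA : ∀ k, IsSemialgebraicFunOn ℚ (Set.pi Set.univ (fun _ : Fin 1 => Set.Icc (0:ℝ) 1)) (fun z => A k (z 0))) (hB : ∀ k, IsSemialgebraicFunOn ℚ (Set.pi Set.univ (fun _ : Fin 1 => Set.Icc (0:ℝ) 1)) (fun z => B k (z 0)))
    (hA' : ∀ k, IsSemialgebraicFunOn ℚ (Set.pi Set.univ (fun _ : Fin 1 => Set.Icc (0:ℝ) 1)) (fun z => A' k (z 0))) (hB' : ∀ k, IsSemialgebraicFunOn ℚ (Set.pi Set.univ (fun _ : Fin 1 => Set.Icc (0:ℝ) 1)) (fun z => B' k (z 0)))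
    (hAc : ∀ k, ContinuousOn (A k) (Set.Icc (0:ℝ) 1)) (hBc : ∀ k, ContinuousOn (B k) (Set.Icc (0:ℝ) 1))
    (hA'c : ∀ k, ContinuousOn (A' k) (Set.Icc (0:ℝ) 1)) (hB'c : ∀ k, ContinuousOn (B' k) (Set.Icc (0:ℝ) 1))
    (hAd : ∀ k, ∀ u ∈ Set.Ioo (0:ℝ) 1, HasDerivAt (A k) (A' k u) u) (hBd : ∀ k, ∀ u ∈ Set.Ioo (0:ℝ) 1, HasDerivAt (B k) (B' k u) u)
    (hd : ∀ k, IsAlgebraic ℚ (d k)) (hAB : ∀ k, ∀ u ∈ Set.Icc (0:ℝ) 1, A k u ^ 2 + B k u ^ 2 ≠ 0)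
    (t : IntegralRep 1) (ht : t.domain = Set.pi Set.univ (fun _ : Fin 1 => Set.Icc (0:ℝ) 1))
    (hti : ∀ z ∈ Set.pi Set.univ (fun _ : Fin 1 => Set.Icc (0:ℝ) 1), t.integrand z =
      ∑ k, d k * ((A k (z 0) * B' k (z 0) - A' k (z 0) * B k (z 0)) / (A k (z 0) ^ 2 + B k (z 0) ^ 2)))
    (hv : t.value = 0) : FibStokesDecomposable 1 t.integrand := by
  classical
  -- the angular derivatives and total angles
  set ω : Fin s → ℝ → ℝ := fun k u => (A k u * B' k u - A' k u * B k u) / (A k u ^ 2 + B k u ^ 2) with hω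
  set Θ : Fin s → ℝ := fun k => ∫ u in (0:ℝ)..1, ω k u with hΘ
  have hωc : ∀ k, ContinuousOn (ω k) (Set.Icc (0:ℝ) 1) := fun k =>
    saLoopAngle_integrand_continuousOn (hAc k) (hBc k) (hA'c k) (hB'c k) (hAB k)
  have hωi : ∀ k, IntervalIntegrable (ω k) volume 0 1 := fun k =>
    (hωc k).intervalIntegrable_of_Icc zero_le_one
  -- the value: `Σ dₖ Θₖ = 0`
  have hval : t.value = ∑ k, d k * Θ k := by
    rw [value_cubeRep_one_eq_intervalIntegral t (fun u => ∑ k, d k * ω k u) ht (fun z hz => by rw [hti z hz]),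
      intervalIntegral.integral_finsetSum fun k _ => (hωi k).const_mul (d k)]
    exact Finset.sum_congr rfl fun k _ => intervalIntegral.integral_const_mul _ _
  have hrel : (0:ℝ) + ∑ i : Fin 0, (Fin.elim0 i : ℝ) * Real.log ((Fin.elim0 i : ℝ)) + ∑ k, d k * Θ k = 0 := by
    rw [Finset.univ_eq_empty, Finset.sum_empty, add_zero, zero_add, ← hval, hv]
  -- mixed Baker with no logarithms
  have hθa : ∀ k, IsAlgebraic ℚ (Complex.exp ((Θ k : ℂ) * Complex.I)) := fun k =>
    stub_saLoopAngleExp (A k) (B k) (A' k) (B' k) (hA k) (hB k) (hAc k) (hBc k) (hA'c k) (hB'c k) (hAd k) (hBd k) (hAB k)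
  obtain ⟨-, tq, Mq, Nq, c, hc, -, hN, -, hdN⟩ :=
    stub_rungMixedBaker 0 s Fin.elim0 Θ 0 Fin.elim0 d (fun i => i.elim0) (fun i => i.elim0) hθa
      isAlgebraic_zero (fun i => i.elim0) hd hrel
  -- the product loops
  have hloop := fun q => stub_saLoopZPow s A B A' B' (Nq q) hA hB hA' hB' hAc hBc hA'c hB'c hAd hBd hAB
  choose P Q P' Q' hP hQ hP' hQ' hPc hQc hP'c hQ'c hPd hQd hPQ hω' using hloop
  set ω' : Fin tq → ℝ → ℝ := fun q u => (P q u * Q' q u - P' q u * Q q u) / (P q u ^ 2 + Q q u ^ 2) with hω'def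
  have hS1 := isSemialgebraic_cubePi_one
  -- their representations, of value `0`
  have hrep := fun q => exists_cubeRep_one (fun u => (1:ℝ) * ω' q u)
    ((isSemialgebraicFunOn_const_of_isAlgebraic hS1 isAlgebraic_one).fun_mul
      ((((hP q).fun_mul (hQ' q)).fun_sub ((hP' q).fun_mul (hQ q))).div (((hP q).fun_pow 2).fun_add ((hQ q).fun_pow 2))
        fun z hz => hPQ q (z 0) (hz 0 (Set.mem_univ _))))
    (continuousOn_const.mul (saLoopAngle_integrand_continuousOn (hPc q) (hQc q) (hP'c q) (hQ'c q) (hPQ q)))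
  choose r hrd hri using hrep
  have hrv : ∀ q, (r q).value = 0 := by
    intro q
    rw [value_cubeRep_one_eq_intervalIntegral (r q) (fun u => (1:ℝ) * ω' q u) (hrd q) (fun z _ => by rw [hri q]),
      intervalIntegral.integral_congr (g := fun u => ∑ k, (Nq q k : ℝ) * ω k u) (fun u hu => by
        rw [Set.uIcc_of_le zero_le_one] at hu
        show (1:ℝ) * ω' q u = ∑ k, (Nq q k : ℝ) * ω k u
        rw [one_mul]; exact hω' q u hu),
      intervalIntegral.integral_finsetSum fun k _ => (hωi k).const_mul _]
    simp only [intervalIntegral.integral_const_mul]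
    exact hN q
  -- rung 4 on each product loop, scalars, sum
  have hdec : ∀ q, FibStokesDecomposable 1 (r q).integrand := fun q =>
    fibStokesDecomposable_saAngularSector 1 (P q) (Q q) (P' q) (Q' q) isAlgebraic_one (hP q) (hQ q) (hP' q) (hQ' q)
      (hPc q) (hQc q) (hP'c q) (hQ'c q) (hPd q) (hQd q) (hPQ q) (r q) (hrd q) (fun z _ => by rw [hri q]) (hrv q)
  have hsum : FibStokesDecomposable 1 (fun z => ∑ q ∈ Finset.univ, c q * (r q).integrand z) :=
    fibStokesDecomposable_finsetSum Finset.univ (fun q z => c q * (r q).integrand z) fun q _ =>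
      fibStokesDecomposable_const_mul 1 (c q) _ (hc q) (hdec q)
  refine fibStokesDecomposable_congr_off_null 1 _ _ ∅ Literature.ModelTheory.ExponentialFields.isSemialgebraic_empty
    measure_empty (fun z hz _ => ?_) hsum
  -- the pointwise identity on the cube
  have hz0 : z 0 ∈ Set.Icc (0:ℝ) 1 := hz 0 (Set.mem_univ _)
  rw [hti z hz]
  simp only [hri, one_mul]
  calc ∑ q, c q * ω' q (z 0) = ∑ q, c q * ∑ k, (Nq q k : ℝ) * ω k (z 0) :=
        Finset.sum_congr rfl fun q _ => congrArg (c q * ·) (hω' q (z 0) hz0)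
    _ = ∑ q, ∑ k, c q * ((Nq q k : ℝ) * ω k (z 0)) := by simp only [Finset.mul_sum]
    _ = ∑ k, ∑ q, c q * ((Nq q k : ℝ) * ω k (z 0)) := Finset.sum_comm
    _ = ∑ k, (∑ q, c q * (Nq q k : ℝ)) * ω k (z 0) := by
        refine Finset.sum_congr rfl fun k _ => ?_; rw [Finset.sum_mul]; simp only [mul_assoc]
    _ = ∑ k, d k * ω k (z 0) := by simp only [← hdN]


/-- **S2 on the whole mixed layer of dimension one with SEMIALGEBRAIC data (rung 10c, part II; lead c5)** — every logarithmic
differential `dG₀ + Σ cᵢ dlog fᵢ + Σ dₖ d arg(Aₖ + iBₖ)` with `ℚ`-semialgebraic `C¹` data and value `0` is fibrewise-Stokes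
decomposable (everything below genus one): value formula (`stub_saMixedValue`, p132668), mixed Baker separates the dlog and angular
halves, rung 10a + part I. [cite: Baker1975, Thm 2.1] -/
theorem fibStokesDecomposable_saDimOneMixed (s : ℕ) (f f' : Fin s → ℝ → ℝ) (c : Fin s → ℝ)
    (s' : ℕ) (A B A' B' : Fin s' → ℝ → ℝ) (d : Fin s' → ℝ) (G₀ g₀ : ℝ → ℝ)
    (hf : ∀ i, IsSemialgebraicFunOn ℚ (Set.pi Set.univ (fun _ : Fin 1 => Set.Icc (0:ℝ) 1)) (fun z => f i (z 0)))
    (hf' : ∀ i, IsSemialgebraicFunOn ℚ (Set.pi Set.univ (fun _ : Fin 1 => Set.Icc (0:ℝ) 1)) (fun z => f' i (z 0)))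
    (hc : ∀ i, IsAlgebraic ℚ (c i)) (hpos : ∀ i, ∀ u ∈ Set.Icc (0:ℝ) 1, 0 < f i u)
    (hfc : ∀ i, ContinuousOn (f i) (Set.Icc (0:ℝ) 1)) (hf'c : ∀ i, ContinuousOn (f' i) (Set.Icc (0:ℝ) 1))
    (hfd : ∀ i, ∀ u ∈ Set.Ioo (0:ℝ) 1, HasDerivAt (f i) (f' i u) u)
    (hA : ∀ k, IsSemialgebraicFunOn ℚ (Set.pi Set.univ (fun _ : Fin 1 => Set.Icc (0:ℝ) 1)) (fun z => A k (z 0))) (hB : ∀ k, IsSemialgebraicFunOn ℚ (Set.pi Set.univ (fun _ : Fin 1 => Set.Icc (0:ℝ) 1)) (fun z => B k (z 0)))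
    (hA' : ∀ k, IsSemialgebraicFunOn ℚ (Set.pi Set.univ (fun _ : Fin 1 => Set.Icc (0:ℝ) 1)) (fun z => A' k (z 0))) (hB' : ∀ k, IsSemialgebraicFunOn ℚ (Set.pi Set.univ (fun _ : Fin 1 => Set.Icc (0:ℝ) 1)) (fun z => B' k (z 0)))
    (hAc : ∀ k, ContinuousOn (A k) (Set.Icc (0:ℝ) 1)) (hBc : ∀ k, ContinuousOn (B k) (Set.Icc (0:ℝ) 1))
    (hA'c : ∀ k, ContinuousOn (A' k) (Set.Icc (0:ℝ) 1)) (hB'c : ∀ k, ContinuousOn (B' k) (Set.Icc (0:ℝ) 1))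
    (hAd : ∀ k, ∀ u ∈ Set.Ioo (0:ℝ) 1, HasDerivAt (A k) (A' k u) u) (hBd : ∀ k, ∀ u ∈ Set.Ioo (0:ℝ) 1, HasDerivAt (B k) (B' k u) u)
    (hd : ∀ k, IsAlgebraic ℚ (d k)) (hAB : ∀ k, ∀ u ∈ Set.Icc (0:ℝ) 1, A k u ^ 2 + B k u ^ 2 ≠ 0)
    (hG₀ : IsSemialgebraicFunOn ℚ (Set.pi Set.univ (fun _ : Fin 1 => Set.Icc (0:ℝ) 1)) (fun z => G₀ (z 0)))
    (hg₀ : IsSemialgebraicFunOn ℚ (Set.pi Set.univ (fun _ : Fin 1 => Set.Icc (0:ℝ) 1)) (fun z => g₀ (z 0)))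
    (hder : ∀ u ∈ Set.Icc (0:ℝ) 1, HasDerivAt G₀ (g₀ u) u) (hg₀c : ContinuousOn g₀ (Set.Icc (0:ℝ) 1))
    (t : IntegralRep 1) (ht : t.domain = Set.pi Set.univ (fun _ : Fin 1 => Set.Icc (0:ℝ) 1))
    (hti : ∀ z ∈ Set.pi Set.univ (fun _ : Fin 1 => Set.Icc (0:ℝ) 1), t.integrand z =
      g₀ (z 0) + ∑ i, c i * (f' i (z 0) / f i (z 0)) +
        ∑ k, d k * ((A k (z 0) * B' k (z 0) - A' k (z 0) * B k (z 0)) / (A k (z 0) ^ 2 + B k (z 0) ^ 2)))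
    (hv : t.value = 0) : FibStokesDecomposable 1 t.integrand := by
  classical
  have hS := isSemialgebraic_cubePi_one
  have h0 : (0:ℝ) ∈ Set.Icc (0:ℝ) 1 := ⟨le_rfl, zero_le_one⟩
  have h1 : (1:ℝ) ∈ Set.Icc (0:ℝ) 1 := ⟨zero_le_one, le_rfl⟩
  -- the angular derivatives, the total angles
  set ω : Fin s' → ℝ → ℝ := fun k u => (A k u * B' k u - A' k u * B k u) / (A k u ^ 2 + B k u ^ 2) with hω
  set Θ : Fin s' → ℝ := fun k => ∫ u in (0:ℝ)..1, ω k u with hΘ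
  have hωc : ∀ k, ContinuousOn (ω k) (Set.Icc (0:ℝ) 1) := fun k =>
    saLoopAngle_integrand_continuousOn (hAc k) (hBc k) (hA'c k) (hB'c k) (hAB k)
  have hωi : ∀ k, IntervalIntegrable (ω k) volume 0 1 := fun k =>
    (hωc k).intervalIntegrable_of_Icc zero_le_one
  -- algebraicity of the data of the value
  have hβ : IsAlgebraic ℚ (G₀ 1 - G₀ 0) := by
    have e1 := hG₀.isAlgebraic_apply (a := fun _ => (1:ℝ)) (fun _ _ => h1) fun _ => isAlgebraic_one
    have e0 := hG₀.isAlgebraic_apply (a := fun _ => (0:ℝ)) (fun _ _ => h0) fun _ => isAlgebraic_zero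
    exact mem_algebraicClosure_iff.mp
      (sub_mem (mem_algebraicClosure_iff.mpr e1) (mem_algebraicClosure_iff.mpr e0))
  have hεpos : ∀ i, 0 < f i 1 / f i 0 := fun i => div_pos (hpos i 1 h1) (hpos i 0 h0)
  have hεalg : ∀ i, IsAlgebraic ℚ (f i 1 / f i 0) := fun i => by
    have e1 := (hf i).isAlgebraic_apply (a := fun _ => (1:ℝ)) (fun _ _ => h1) fun _ => isAlgebraic_one
    have e0 := (hf i).isAlgebraic_apply (a := fun _ => (0:ℝ)) (fun _ _ => h0) fun _ => isAlgebraic_zero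
    exact mem_algebraicClosure_iff.mp
      (div_mem (mem_algebraicClosure_iff.mpr e1) (mem_algebraicClosure_iff.mpr e0))
  have hθa : ∀ k, IsAlgebraic ℚ (Complex.exp ((Θ k : ℂ) * Complex.I)) := fun k =>
    stub_saLoopAngleExp (A k) (B k) (A' k) (B' k) (hA k) (hB k) (hAc k) (hBc k) (hA'c k) (hB'c k) (hAd k) (hBd k) (hAB k)
  -- the value and the mixed Baker step
  have hval := stub_saMixedValue s f f' c s' A B A' B' d G₀ g₀ hpos hfc hf'c hfd hAB hAc hBc hA'c hB'c hder hg₀c t ht hti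
  rw [hv] at hval
  obtain ⟨hr0, tq, Mq, Nq, cq, -, hM, hN, hcM, hdN⟩ :=
    stub_rungMixedBaker s s' (fun i => f i 1 / f i 0) Θ (G₀ 1 - G₀ 0) c d hεpos hεalg hθa hβ hc
      hd hval.symm
  -- the two halves of the value vanish separately
  have hlog0 : ∑ i, c i * Real.log (f i 1 / f i 0) = 0 := by
    calc ∑ i, c i * Real.log (f i 1 / f i 0)
        = ∑ i, (∑ q, cq q * (Mq q i : ℝ)) * Real.log (f i 1 / f i 0) := by simp only [← hcM]
      _ = ∑ q, cq q * ∑ i, (Mq q i : ℝ) * Real.log (f i 1 / f i 0) := by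
          simp only [Finset.sum_mul, Finset.mul_sum, mul_assoc]; exact Finset.sum_comm
      _ = ∑ q, cq q * Real.log (∏ i, (f i 1 / f i 0) ^ (Mq q i)) := by
          refine Finset.sum_congr rfl fun q _ => ?_
          rw [Real.log_prod fun i _ => (zpow_pos (hεpos i) _).ne']
          simp only [Real.log_zpow]
      _ = 0 := by simp only [hM, Real.log_one, mul_zero, Finset.sum_const_zero]
  have hang0 : ∑ k, d k * Θ k = 0 := by
    calc ∑ k, d k * Θ k = ∑ k, (∑ q, cq q * (Nq q k : ℝ)) * Θ k := by simp only [← hdN]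
      _ = ∑ q, cq q * ∑ k, (Nq q k : ℝ) * Θ k := by
          simp only [Finset.sum_mul, Finset.mul_sum, mul_assoc]; exact Finset.sum_comm
      _ = 0 := by simp only [hN, mul_zero, Finset.sum_const_zero]
  -- the exact + dlog representation, of value `0`, decomposable by rung 2
  set h₁ : ℝ → ℝ := fun u => g₀ u + ∑ i, c i * (f' i u / f i u) with hh₁
  have h₁sa : IsSemialgebraicFunOn ℚ (Set.pi Set.univ (fun _ : Fin 1 => Set.Icc (0:ℝ) 1)) (fun z => h₁ (z 0)) :=
    hg₀.fun_add (IsSemialgebraicFunOn.fun_finsetSum _ hS fun i _ =>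
      (isSemialgebraicFunOn_const_of_isAlgebraic hS (hc i)).fun_mul ((hf' i).div (hf i)
        fun z hz => (hpos i (z 0) (hz 0 (Set.mem_univ _))).ne'))
  have h₁c : ContinuousOn h₁ (Set.Icc (0:ℝ) 1) :=
    hg₀c.add (continuousOn_finsetSum _ fun i _ => continuousOn_const.mul ((hf'c i).div (hfc i) fun u hu => (hpos i u hu).ne'))
  obtain ⟨t₁, ht₁, ht₁i⟩ := exists_cubeRep_one h₁ h₁sa h₁c
  have ht₁i' : ∀ z ∈ Set.pi Set.univ (fun _ : Fin 1 => Set.Icc (0:ℝ) 1), t₁.integrand z =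
      g₀ (z 0) + ∑ i, c i * (f' i (z 0) / f i (z 0)) := fun z _ => by
    rw [ht₁i]
  have ht₁v : t₁.value = 0 := by
    rw [stub_saDlogValue s f f' c G₀ g₀ hpos hfc hf'c hfd hder hg₀c t₁ ht₁ ht₁i', hr0, hlog0, add_zero]
  have hdec₁ : FibStokesDecomposable 1 t₁.integrand :=
    fibStokesDecomposable_saDlogSector s f f' c G₀ g₀ hf hf' hc hpos hfc hf'c hfd hG₀ hg₀ hder hg₀c t₁ ht₁ ht₁i' ht₁v
  -- the angular representation, of value `0`, decomposable by part I
  set h₂ : ℝ → ℝ := fun u => ∑ k, d k * ω k u with hh₂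
  have h₂sa : IsSemialgebraicFunOn ℚ (Set.pi Set.univ (fun _ : Fin 1 => Set.Icc (0:ℝ) 1)) (fun z => h₂ (z 0)) :=
    IsSemialgebraicFunOn.fun_finsetSum _ hS fun k _ =>
      (isSemialgebraicFunOn_const_of_isAlgebraic hS (hd k)).fun_mul
        ((((hA k).fun_mul (hB' k)).fun_sub ((hA' k).fun_mul (hB k))).div (((hA k).fun_pow 2).fun_add ((hB k).fun_pow 2))
          fun z hz => hAB k (z 0) (hz 0 (Set.mem_univ _)))
  have h₂c : ContinuousOn h₂ (Set.Icc (0:ℝ) 1) :=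
    continuousOn_finsetSum _ fun k _ => continuousOn_const.mul (hωc k)
  obtain ⟨t₂, ht₂, ht₂i⟩ := exists_cubeRep_one h₂ h₂sa h₂c
  have ht₂i' : ∀ z ∈ Set.pi Set.univ (fun _ : Fin 1 => Set.Icc (0:ℝ) 1), t₂.integrand z =
      ∑ k, d k * ω k (z 0) := fun z _ => by rw [ht₂i]
  have ht₂v : t₂.value = 0 := by
    rw [value_cubeRep_one_eq_intervalIntegral t₂ h₂ ht₂ ht₂i', hh₂]
    show ∫ u in (0:ℝ)..1, ∑ k, d k * ω k u = 0
    rw [intervalIntegral.integral_finsetSum fun k _ => (hωi k).const_mul (d k)]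
    simp only [intervalIntegral.integral_const_mul]
    exact hang0
  have hdec₂ : FibStokesDecomposable 1 t₂.integrand :=
    fibStokesDecomposable_saAngularMulti s' d A B A' B' hA hB hA' hB' hAc hBc hA'c hB'c hAd hBd hd hAB t₂ ht₂ ht₂i' ht₂v
  -- sum and congruence
  refine fibStokesDecomposable_congr_off_null 1 _ _ ∅ Literature.ModelTheory.ExponentialFields.isSemialgebraic_empty
    measure_empty (fun z hz _ => ?_) (fibStokesDecomposable_add 1 _ _ hdec₁ hdec₂)
  rw [hti z hz, ht₁i, ht₂i]


end Summit.KontsevichZagierPeriods.KontsevichZagierPeriods.Cruxes.StokesGeneration.FibrewiseStokes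

end
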